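import Summits.QuantumFields.BalabanUV.T4Continuum.Support.NE7HintOfUhlenbeckChartSU2
import Summits.QuantumFields.BalabanUV.T4Continuum.Support.NE7PairResidualSupRep
import Summits.QuantumFields.BalabanUV.T4Continuum.Support.AveragingDeficitMultiLevelBridge
import HarnessLib

/-!
# Support | NE7 END OF RECORD over `NE7HintOfUhlenbeckChartSU2.hint_SU2` (F324): THE SUP HALF OF ROW NE3's PER-PAIR BINDER DISCHARGED — `hleaves` is replaced
# by `hleaves♭`, the SLICE NORMALISATION of a GIVEN residual near-representative (the near-representative itself is now a theorem:
# `NE7PairResidualSupRep.pair_residual_sup_rep`, gen 94)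

Informal class name: ROW NE7's HINT THEOREM WITH THE PAIR'S RELATIVE SUP DATUM SUPPLIED.

`NE7HintOfUhlenbeckChartSU2.hint_SU2` (gen 93's END of the NE7 record) takes, besides the two numeric lines, ROW NE3's per-pair binder `hleaves`: for every
tangent-critical admissible `U_s` and every admissible `U′` over the same datum, a RESIDUAL SLICE REPRESENTATIVE (`ResidualSliceRepT`: a unitary periodic
corner-trivial gauge `u`, `U′^{u} = U_s·e^{X₀}` with `X₀` in the slice `T_♮(U_s)`, `‖X₀‖ ≤ α₀`) with the weight∕currencies (`α₀M ≤ α̂`, `mM ≤ α̂`, `C ≤ Ĉ`, the local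
quadratic letter).  Gen 94 proves the SUP HALF of this binder for ARBITRARY pairs: `pair_residual_sup_rep` — two unitary `(N·M)`-periodic configurations with plaquettes
`ε∕M²`-close to `1` and the same `(k+1)`-fold average have a unitary `(N·M)`-periodic corner-trivial gauge `u₀` with `‖U_s(b)⁻¹U′^{u₀}(b) − 1‖ ≤ 10³⁴ε∕M` on every bond
([Balaban1985RegularSpaces] Lemma 1 ∕ Thm 2 (1.36)₁ TYPE at a pair; OUR road: cube Landau charts of gen 93's engine, corner consistency from the iterated-average segment
letter, two-party geodesic gluing over the 16 block parities, four period halvings — files F315–F323b).  THIS FILE's END therefore asks only for `hleaves♭`: the SAME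
conclusion as `hleaves`, but from the ADDITIONAL premise of such a near-representative `u₀` — i.e. the slice normalisation (the exact `T_♮(U_s)` condition by a small
residual gauge correction, [Balaban1985RegularSpaces] Sects. D–E TYPE) and the currencies; `ε₀` shrinks to `≤ 1∕(2·10²¹)` so that `pair_residual_sup_rep`'s regime holds
at `card n = 2`.

HONEST LABEL: finite T⁴ rung (B)+1 — NOT infinite volume, NOT mass gap, NOT `BetaPertH`, NOT Clay.  `hleaves♭` and the numeric lines are HYPOTHESES asserted for nothing;
nothing of Bałaban's asserted; NE7 NOT PROVED; spine 0∕9.  No `sorry`; axioms ⊆ {propext, Classical.choice, Quot.sound}.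

Worked on by: prover-b2b-balaban-t4-ne7-p1-g94-0 (lineage b2b-balaban-t4-ne7-p1, gen 94: F324, the END over F314b).
-/

open scoped BigOperators Matrix Matrix.Norms.L2Operator Topology
open NormedSpace Finset Set Filter

namespace Summit.QuantumFields.BalabanUV.T4Continuum.NE7HintOfSliceNormalisationSU2

open Literature.MathematicalPhysics.QuantumFieldTheory.Balaban1983to89
open B7Prop1Explicit B7Prop2Explicit MatrixLog UnitaryModel MatrixNorms
open T4AveragingDeficitWall (Ad IsUnitaryCfg IsSkewDir SmallField vary curl curlSq dirSq dirL1)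
open T4AveragingDeficitWallBoundary (IsPeriodicCfg periodBox)
open AveragingDeficitPeriodicCounting (IsPeriodicDir)
open AveragingDeficitMultiLevelPrep (LevelSmall tower TangentIter cavgIter)
open AveragingDeficitMultiLevelBridge (cavgIter_eq_avgIter)
open BlockAverageVaryHolo (nbRad)
open MinimalActionLevels (perWin)
open MinimalActionSandwich (IsMinimiser admissible)
open MinimalActionRate (sfClass)
open NE3HessForm (dAction)
open NE3SlicePoincareBudgetLine (CPLine)
open NE3TangentCovariantTower (dirIter)
open NE3DecomposedRepOfLinearNormalPart (ResidualSliceRepT)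
open NE3QbarIterCovLiftPrep (cruxC)
open NE3SmoothRightInverseW (rightInvW)
open NE3RightInverseSolveLetters (thetaLoc)
open NE3RightInverseL2Letter (l2C)
open NE3HatInvCurlLetters (curl2C curl1C)
open NE3EnergyShapes (IsUnitarySite IsPeriodicSite)
open NE7HintOfUhlenbeckChartSU2 (hint_SU2)
open NE7PairResidualSupRep (pair_residual_sup_rep)

variable {n : Type} [Fintype n] [DecidableEq n]

/-- **ROW NE7's END OF RECORD, THE PAIR'S RELATIVE SUP DATUM SUPPLIED**: gen 93's `hint_SU2` with ROW NE3's per-pair binder `hleaves` replaced by `hleaves♭` — the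
same slice representative and currencies, but FROM a given residual near-representative `u₀` (unitary, `(N·M)`-periodic, corner-trivial, `‖U_s(b)⁻¹U′^{u₀}(b) − 1‖ ≤
10³⁴ε∕M`), which `NE7PairResidualSupRep.pair_residual_sup_rep` supplies for every admissible pair. [folklore] -/
theorem hint_SU2_of_sliceNormalisation [Nonempty n] (hn : Fintype.card n = 2) :
    ∃ ℓ : ℕ, 1 ≤ ℓ ∧ ∃ ε₀ : ℝ, 0 < ε₀ ∧ ∀ ε : ℝ, 0 < ε → ε ≤ ε₀ → ∃ β₀ : ℝ, 0 < β₀ ∧ ∀ β : ℝ, 0 < β → β ≤ β₀ →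
    ∀ (N : ℕ) [NeZero N] (C₂ αh Ch νh κh : ℝ), 1 ≤ N →
    0 ≤ C₂ → 0 ≤ αh → αh ≤ 1 → 0 ≤ Ch →
    νh = 2 * Real.sqrt (l2C 4 2 / (1 - thetaLoc 4 2 * ε) ^ 2 + curl2C 4 2 / (1 - thetaLoc 4 2 * ε) ^ 2) * C₂ * Ch * αh →
    κh = 4 * (curl1C 4 2 / (1 - thetaLoc 4 2 * ε)) * C₂ * Ch ^ 2 * ε →
    νh < 1 →
    2 * (κh / (1 - νh) ^ 2) < ((((1 / 2 - (νh / (1 - νh)) ^ 2) / (2 * (1 + (CPLine 4 2 2 (1 / 10 ^ 17) (1 / 10 ^ 53) + 1))) - (νh / (1 - νh)) ^ 2) / 2 - 576 * ((4 : ℕ) : ℝ) * (αh ^ 2 * Real.exp (2 * αh))) / (Fintype.card n : ℝ) - 28 * ((4 : ℕ) : ℝ) * (ε + 7 * αh ^ 2)) →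
    -- ROW NE3's PER-PAIR BINDER WITH THE SUP HALF SUPPLIED (`hleaves♭`: slice normalisation + currencies of a residual near-representative)
    (∀ D : Site 4 → Fin 4 → (Matrix n n ℂ)ˣ, IsUnitaryCfg D → IsPeriodicCfg D (N : ℤ) → SmallField D (4 * (Real.exp β - 1)) → ∀ (k : ℕ), ∀ Us ∈ admissible (sfClass 4 2 N ε) 2 (k + 1) D, SmallField Us ((1 / ((2 : ℕ) : ℝ) ^ 2 * ε / 2) / (((2 : ℕ) : ℝ) ^ (k + 1)) ^ 2) → (∀ φ : Site 4 → Fin 4 → Matrix n n ℂ, IsSkewDir φ → IsPeriodicDir φ ((N * 2 ^ (k + 1) : ℕ) : ℤ) → TangentIter 2 k Us φ → dAction Us φ (perWin 4 (N * 2 ^ (k + 1))) = 0) → ∀ U' ∈ admissible (sfClass 4 2 N ε) 2 (k + 1) D,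
      -- NEW (gen 94): GIVEN ANY RESIDUAL NEAR-REPRESENTATIVE — a unitary `(N·M)`-periodic corner-trivial gauge in which `U′` is `10³⁴·ε∕M`-close to `U_s` bondwise
      ∀ u₀ : Site 4 → (Matrix n n ℂ)ˣ, IsUnitarySite u₀ → IsPeriodicSite u₀ ((N * 2 ^ (k + 1) : ℕ) : ℤ) → (∀ z : Site 4, u₀ (((2 ^ (k + 1) : ℕ) : ℤ) • z) = 1) →
        (∀ (x : Site 4) (μ : Fin 4), ‖(((Us x μ)⁻¹ * gaugeAct u₀ U' x μ : (Matrix n n ℂ)ˣ) : Matrix n n ℂ) - 1‖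
          ≤ 10000000000000000000000000000000000 * (2 : ℝ) ^ (k + 1) * (ε / (((2 : ℕ) : ℝ) ^ (k + 1)) ^ 2)) →
      ∃ (u : Site 4 → (Matrix n n ℂ)ˣ) (X₀ : Site 4 → Fin 4 → Matrix n n ℂ) (α₀ : ℝ) (m : Site 4 → Fin 4 → ℝ) (C : ℝ), IsSkewDir X₀ ∧ (∀ (hWu : IsUnitaryCfg Us) (hx : 0 ≤ ε / (((2 : ℕ) : ℝ) ^ (k + 1)) ^ 2) (hs : LevelSmall 4 2 k (ε / (((2 : ℕ) : ℝ) ^ (k + 1)) ^ 2)) (hWx : SmallField Us (ε / (((2 : ℕ) : ℝ) ^ (k + 1)) ^ 2)) (hθ : cruxC 4 2 * ((((2 : ℕ) : ℝ) ^ (k + 1)) ^ 2 * (ε / (((2 : ℕ) : ℝ) ^ (k + 1)) ^ 2)) < 1) (hφ : IsSkewDir (dirIter 2 (k + 1) Us X₀)), ResidualSliceRepT 2 N (k + 1) Us U' u X₀ (rightInvW (by norm_num) k hWu hx hs hWx N hθ hφ) α₀) ∧ (∀ z κ, 0 ≤ m z κ) ∧ 0 ≤ C ∧ (((2 : ℕ)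 : ℝ) ^ (k + 1)) ^ 4 * ∑ z ∈ periodBox (d := 4) N, ∑ κ : Fin 4, m z κ ^ 2 ≤ C ^ 2 * dirSq X₀ (periodBox (d := 4) (N * 2 ^ (k + 1))) ∧ (∀ z ∈ periodBox (d := 4) N, ∀ κ : Fin 4, ‖dirIter 2 (k + 1) Us X₀ z κ‖ ≤ C₂ * (((2 : ℕ) : ℝ) ^ (k + 1) * m z κ) ^ 2) ∧ α₀ * ((2 : ℕ) : ℝ) ^ (k + 1) ≤ αh ∧ (∀ z κ, m z κ * ((2 : ℕ) : ℝ) ^ (k + 1) ≤ αh) ∧ C ≤ Ch) →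
    ∃ δV : ℝ, 0 < δV ∧
      ∀ V ∈ {V : Site 4 → Fin 4 → (Matrix n n ℂ)ˣ | IsUnitaryCfg V ∧ IsPeriodicCfg V (N : ℤ) ∧ SmallField V δV},
      ∀ k : ℕ, ∃ U : Site 4 → Fin 4 → (Matrix n n ℂ)ˣ, IsMinimiser 4 (sfClass 4 2 N ε) 2 N k V U ∧
        ∃ a : ℝ, 0 ≤ a ∧ a < ε / (((2 : ℕ) : ℝ) ^ k) ^ 2 ∧ SmallField U a := by

  obtain ⟨ℓ, hℓ1, ε₀, hε₀, H⟩ := hint_SU2 (n := n) hn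
  refine ⟨ℓ, hℓ1, min ε₀ (1 / 2000000000000000000000), lt_min hε₀ (by norm_num), fun ε hε hεle => ?_⟩
  obtain ⟨β₀, hβ₀, H2⟩ := H ε hε (hεle.trans (min_le_left _ _))
  refine ⟨β₀, hβ₀, fun β hβ hβle N _ C₂ αh Ch νh κh hN hC₂ hαh0 hαh1 hCh0 hνh hκh hν hline hleaves => ?_⟩
  have hε21 : ε ≤ 1 / 2000000000000000000000 := hεle.trans (min_le_right _ _)
  refine H2 β hβ hβle N C₂ αh Ch νh κh hN hC₂ hαh0 hαh1 hCh0 hνh hκh hν hline ?_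
  intro D hD hDP hDS k Us hUs hUsS hcrit U' hU'
  -- the pair's relative sup datum from `pair_residual_sup_rep`
  have hUs' : IsUnitaryCfg Us ∧ IsPeriodicCfg Us ((N * 2 ^ (k + 1) : ℕ) : ℤ) ∧ SmallField Us (ε / (((2 : ℕ) : ℝ) ^ (k + 1)) ^ 2) := hUs.1
  have hU'' : IsUnitaryCfg U' ∧ IsPeriodicCfg U' ((N * 2 ^ (k + 1) : ℕ) : ℤ) ∧ SmallField U' (ε / (((2 : ℕ) : ℝ) ^ (k + 1)) ^ 2) := hU'.1
  have htop : cavgIter 2 (k + 1) U' = cavgIter 2 (k + 1) Us := by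
    rw [cavgIter_eq_avgIter, cavgIter_eq_avgIter, hU'.2, hUs.2]
  have hη : 0 < ε / (((2 : ℕ) : ℝ) ^ (k + 1)) ^ 2 := by positivity
  have hθ : 1000000000000000000000 * (Fintype.card n : ℝ) * (((2 : ℝ) ^ (k + 1)) ^ 2 * (ε / (((2 : ℕ) : ℝ) ^ (k + 1)) ^ 2)) ≤ 1 := by
    have hM0 : (0 : ℝ) < ((2 : ℕ) : ℝ) ^ (k + 1) := by positivity
    have hid : ((2 : ℝ) ^ (k + 1)) ^ 2 * (ε / (((2 : ℕ) : ℝ) ^ (k + 1)) ^ 2) = ε := by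
      push_cast at hM0 ⊢; field_simp
    rw [hid, hn]; push_cast; linarith
  obtain ⟨u₀, hu₀U, hu₀P, hu₀pin, hu₀err⟩ :=
    pair_residual_sup_rep hU''.1 hUs'.1 hN hU''.2.1 hUs'.2.1 hη hU''.2.2 hUs'.2.2 htop hθ
  exact hleaves D hD hDP hDS k Us hUs hUsS hcrit U' hU' u₀ hu₀U hu₀P hu₀pin hu₀err

end Summit.QuantumFields.BalabanUV.T4Continuum.NE7HintOfSliceNormalisationSU2
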